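import Summits.KontsevichZagierPeriods.KontsevichZagierPeriods.Theorems.SoloInformedNLFibres
import Summits.KontsevichZagierPeriods.KontsevichZagierPeriods.Theorems.SoloInformedNLMultiplicity
import HarnessLib
import HarnessLib.Audit

/-!
# SoloInformed — base cells of cylinders and reindexing the open cells of an adapted set by (base cell, band index) (Newton–Leibniz elimination, file 4c-ii-a)

Solo programme `solo-KontsevichZagierPeriods-informed`, session s245 (K-NF, `paper/nl-elimination.md`
§7.2, FILE 4c-ii).

Generic bookkeeping for a `ℚ`-cylindrical decomposition `𝒯` of `ℝⁿ⁺¹` with stack data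
(`𝒮`, sections `ξ S`, `hcont`, `hsa`, `hmono`, `hmem`):

* `soloInformed_base_subset_or_disjoint`: if `𝒯` is adapted to a cylinder `A × ℝ` then every base
  cell lies in `A` or misses it (compare `Literature…SemialgebraicFreeWindowCuts.base_subset_or_disjoint`,
  stated there for `ℝ`-semialgebraic stacks);
* `soloInformed_sum_openCells_eq_sum_bands`: for `𝒯` adapted to `E` (`𝒞 ⊆ 𝒯`, `⋃₀ 𝒞 = E`) and any
  `Φ`, the sum of `Φ` over the OPEN cells of `E` equals the double sum over the open base cells `S` and
  the band indices `j` with `bandOver S (ξ S) j ⊆ E`;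
* `soloInformed_not_mem_image_lastSubst`: the substitution image of a set over `S` has empty fibres
  off `S`.

References: Basu–Pollack–Roy (2006), Def. 5.1; this work (THEOREM NF, `paper/nl-elimination.md`).
-/

noncomputable section

open scoped BigOperators Topology

namespace Summit.KontsevichZagierPeriods.KontsevichZagierPeriods.Theorems

open Set MeasureTheory Filter
open Literature.ModelTheory.ExponentialFields
open Literature.NumberTheory.Transcendental Literature.NumberTheory.Transcendental.KZ

variable {n : ℕ}

variable {𝒯 : Finset (Set (Fin (n + 1) → ℝ))} {𝒮 : Finset (Set (Fin n → ℝ))}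
  {lS : Set (Fin n → ℝ) → ℕ} {ξ : (S : Set (Fin n → ℝ)) → Fin (lS S) → (Fin n → ℝ) → ℝ}

/-- **Base cells versus cylinders.**  If `𝒯` (graphs and bands over the cells of `𝒮`) is adapted
to the cylinder `{z | init z ∈ A}` then every base cell `S ∈ 𝒮` lies in `A` or misses `A` (test
the bottom band over `S`). -/
theorem soloInformed_base_subset_or_disjoint
    (h𝒯 : Setoid.IsPartition (𝒯 : Set (Set (Fin (n + 1) → ℝ))))
    (hmono : ∀ S ∈ 𝒮, ∀ x ∈ S, StrictMono fun j => ξ S j x)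
    (hmem : ∀ T, T ∈ 𝒯 ↔ ∃ S ∈ 𝒮, (∃ j, T = graphOver S (ξ S j)) ∨ ∃ j, T = bandOver S (ξ S) j)
    {A : Set (Fin n → ℝ)} {𝒞 : Finset (Set (Fin (n + 1) → ℝ))} (h𝒞 : 𝒞 ⊆ 𝒯)
    (hU : ⋃₀ (𝒞 : Set (Set (Fin (n + 1) → ℝ))) = {z : Fin (n + 1) → ℝ | Fin.init z ∈ A})
    {S : Set (Fin n → ℝ)} (hS : S ∈ 𝒮) : S ⊆ A ∨ Disjoint S A := by
  have hT : bandOver S (ξ S) 0 ∈ 𝒯 := (hmem _).2 ⟨S, hS, Or.inr ⟨0, rfl⟩⟩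
  rcases soloInformed_cell_subset_or_disjoint h𝒯 h𝒞 hU hT with h | h
  · left
    intro x hx
    obtain ⟨t, ht⟩ := CylindricalDecomposition.exists_mem_band (ξ S) x (hmono S hS x hx) 0
    have := h (snoc_mem_bandOver_iff.2 ⟨hx, ht⟩)
    simpa using this
  · right
    refine disjoint_left.2 fun x hxS hxA => ?_
    obtain ⟨t, ht⟩ := CylindricalDecomposition.exists_mem_band (ξ S) x (hmono S hS x hxS) 0
    exact disjoint_left.1 h (snoc_mem_bandOver_iff.2 ⟨hxS, ht⟩) (by simpa using hxA)

/-- An open cell of a `ℚ`-cylindrical decomposition has positive measure, so it is not contained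
in a null set (used to place open base cells inside the smooth/sign loci). -/
theorem soloInformed_not_subset_of_isOpen_of_volume_eq_zero (h𝒮 : IsCylindricalDecomposition ℚ n 𝒮)
    {S : Set (Fin n → ℝ)} (hS : S ∈ 𝒮) (hSo : IsOpen S) {N : Set (Fin n → ℝ)}
    (hN : volume N = 0) : ¬ S ⊆ N := fun h =>
  soloInformed_cad_volume_ne_zero_of_isOpen h𝒮 hS hSo (measure_mono_null h hN)

/-- A band over `S` and a band over `S'` (cells of the partition `𝒮`) with a common point have
`S = S'` and the same index. -/
theorem soloInformed_bandOver_inj (h𝒮 : Setoid.IsPartition (𝒮 : Set (Set (Fin n → ℝ))))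
    (hmono : ∀ S ∈ 𝒮, ∀ x ∈ S, StrictMono fun j => ξ S j x)
    {S S' : Set (Fin n → ℝ)} (hS : S ∈ 𝒮) (hS' : S' ∈ 𝒮) {j : Fin (lS S + 1)}
    {j' : Fin (lS S' + 1)} (h : bandOver S (ξ S) j = bandOver S' (ξ S') j') :
    (⟨S, j⟩ : Σ S : Set (Fin n → ℝ), Fin (lS S + 1)) = ⟨S', j'⟩ := by
  have hne : S.Nonempty := by
    rw [nonempty_iff_ne_empty]
    rintro rfl
    exact h𝒮.1 hS
  obtain ⟨x, hx⟩ := hne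
  have hm := hmono S hS x hx
  obtain ⟨t, ht⟩ := CylindricalDecomposition.exists_mem_band (ξ S) x hm j
  have hz : (Fin.snoc x t : Fin (n + 1) → ℝ) ∈ bandOver S' (ξ S') j' :=
    h ▸ snoc_mem_bandOver_iff.2 ⟨hx, ht⟩
  obtain ⟨hx', ht'⟩ := snoc_mem_bandOver_iff.1 hz
  obtain rfl : S' = S := by
    obtain ⟨U, -, huniq⟩ := h𝒮.2 x
    exact (huniq S' ⟨Finset.mem_coe.mpr hS', hx'⟩).trans
      (huniq S ⟨Finset.mem_coe.mpr hS, hx⟩).symm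
  obtain rfl : j = j' := CylindricalDecomposition.band_eq_band (ξ S') x hm ht ht'
  rfl

open Classical in
/-- **Reindexing the open cells of an adapted set.**  If `𝒯` is adapted to `E` then, for any
`Φ`, `∑_{C ∈ 𝒞 open} Φ C = ∑_{S ∈ 𝒮 open} ∑_{j : bandOver S (ξ S) j ⊆ E} Φ (bandOver S (ξ S) j)`:
the open cells of `E` are exactly the bands inside `E` over open base cells. -/
theorem soloInformed_sum_openCells_eq_sum_bands
    (h𝒯 : IsCylindricalDecomposition ℚ (n + 1) 𝒯) (h𝒮 : IsCylindricalDecomposition ℚ n 𝒮)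
    (hcont : ∀ S ∈ 𝒮, ∀ j, ContinuousOn (ξ S j) S)
    (hsa : ∀ S ∈ 𝒮, ∀ j, IsSemialgebraicFunOn ℚ S (ξ S j))
    (hmono : ∀ S ∈ 𝒮, ∀ x ∈ S, StrictMono fun j => ξ S j x)
    (hmem : ∀ T, T ∈ 𝒯 ↔ ∃ S ∈ 𝒮, (∃ j, T = graphOver S (ξ S j)) ∨ ∃ j, T = bandOver S (ξ S) j)
    {E : Set (Fin (n + 1) → ℝ)} {𝒞 : Finset (Set (Fin (n + 1) → ℝ))} (h𝒞 : 𝒞 ⊆ 𝒯)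
    (hU : ⋃₀ (𝒞 : Set (Set (Fin (n + 1) → ℝ))) = E) {M : Type*} [AddCommMonoid M]
    (Φ : Set (Fin (n + 1) → ℝ) → M) :
    ∑ C ∈ 𝒞.filter IsOpen, Φ C =
      ∑ S ∈ 𝒮.filter IsOpen, ∑ j ∈ Finset.univ.filter
        (fun j : Fin (lS S + 1) => bandOver S (ξ S) j ⊆ E), Φ (bandOver S (ξ S) j) := by
  set σ : Finset (Σ S : Set (Fin n → ℝ), Fin (lS S + 1)) :=
    (𝒮.filter IsOpen).sigma fun S =>
      Finset.univ.filter fun j : Fin (lS S + 1) => bandOver S (ξ S) j ⊆ E with hσ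
  have hrhs : ∑ S ∈ 𝒮.filter IsOpen, ∑ j ∈ Finset.univ.filter
      (fun j : Fin (lS S + 1) => bandOver S (ξ S) j ⊆ E), Φ (bandOver S (ξ S) j) =
      ∑ p ∈ σ, Φ (bandOver p.1 (ξ p.1) p.2) := by
    rw [hσ, Finset.sum_sigma]
  have hinj : Set.InjOn (fun p : (Σ S : Set (Fin n → ℝ), Fin (lS S + 1)) =>
      bandOver p.1 (ξ p.1) p.2) σ := by
    rintro ⟨S, j⟩ hp ⟨S', j'⟩ hp' heq
    rw [hσ, Finset.mem_coe, Finset.mem_sigma, Finset.mem_filter] at hp hp'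
    exact soloInformed_bandOver_inj h𝒮.isPartition hmono hp.1.1 hp'.1.1 heq
  have himage : 𝒞.filter IsOpen =
      σ.image fun p : (Σ S : Set (Fin n → ℝ), Fin (lS S + 1)) => bandOver p.1 (ξ p.1) p.2 := by
    ext C
    rw [Finset.mem_filter, Finset.mem_image]
    constructor
    · rintro ⟨hC, hCo⟩
      obtain ⟨S, hS, hSo, j, rfl⟩ :=
        soloInformed_exists_bandOver_of_isOpen h𝒯 h𝒮 hsa hmem (h𝒞 hC) hCo
      refine ⟨⟨S, j⟩, ?_, rfl⟩
      rw [hσ, Finset.mem_sigma, Finset.mem_filter, Finset.mem_filter]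
      exact ⟨⟨hS, hSo⟩, Finset.mem_univ _, hU ▸ subset_sUnion_of_mem hC⟩
    · rintro ⟨⟨S, j⟩, hp, rfl⟩
      rw [hσ, Finset.mem_sigma, Finset.mem_filter, Finset.mem_filter] at hp
      obtain ⟨⟨hS, hSo⟩, -, hsub⟩ := hp
      have hT : bandOver S (ξ S) j ∈ 𝒯 := (hmem _).2 ⟨S, hS, Or.inr ⟨j, rfl⟩⟩
      exact ⟨soloInformed_cell_mem_of_subset h𝒯.isPartition h𝒞 hU hT hsub,
        soloInformed_isOpen_bandOver hSo (hcont S hS) j⟩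
  rw [hrhs, himage, Finset.sum_image hinj]

/-- The substitution `Ψ_F` preserves the base point: a point `w` with `init w ∉ S` is not in the
image `Ψ_F '' D` of a set `D` over `S`. -/
theorem soloInformed_not_mem_image_lastSubst {F : (Fin (n + 1) → ℝ) → ℝ}
    {D : Set (Fin (n + 1) → ℝ)} {S : Set (Fin n → ℝ)} (hDS : ∀ z ∈ D, Fin.init z ∈ S)
    {w : Fin (n + 1) → ℝ} (hw : Fin.init w ∉ S) : w ∉ soloInformedLastSubst F '' D := by
  rintro ⟨z, hz, rfl⟩
  exact hw (by rw [soloInformed_init_lastSubst]; exact hDS z hz)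

/-- Points of a band over `S` have base point in `S`. -/
theorem soloInformed_init_mem_of_mem_bandOver {S : Set (Fin n → ℝ)} {l : ℕ}
    {ξ : Fin l → (Fin n → ℝ) → ℝ} {j : Fin (l + 1)} {z : Fin (n + 1) → ℝ}
    (hz : z ∈ bandOver S ξ j) : Fin.init z ∈ S :=
  (mem_bandOver_iff.1 hz).1

/-- Points of the slab `band S p q` have base point in `S`. -/
theorem soloInformed_init_mem_of_mem_band {S : Set (Fin n → ℝ)} {p q : (Fin n → ℝ) → ℝ}
    {z : Fin (n + 1) → ℝ} (hz : z ∈ KZlog.band S p q) : Fin.init z ∈ S :=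
  (KZlog.mem_band.1 hz).1

end Summit.KontsevichZagierPeriods.KontsevichZagierPeriods.Theorems
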